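import Mathlib.RingTheory.DedekindDomain.AdicValuation
import Literature.IUT.LogThetaLattice.GlobalKummerNonInterferenceRemark3101Model
import HarnessLib

/-!
# [IUTchIII] Remark 3.10.1 (i)/(ii) — the `MOD`/`𝔪𝔬𝔡` contrast AT THE GENUINE LOCAL PORTION `(F_v, 𝒪_v)` of `F_mod`
# (proof-only sequel of `GlobalKummerNonInterferenceRemark3101Model.lean`)

S. Mochizuki, *Inter-universal Teichmüller theory III*, kurims manuscript (May 2020), Remark 3.10.1 (i)/(ii),
pp. 149–150; pinned by the proof of Cor. 3.12 at Steps (ix)/(x), p. 180 [claim: Mochizuki2012, status: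
disputed — nothing of the series is asserted here].

The model file (abc-iut-w4-d002 gen 2, p432249) proves `remark3101ii_contrast_model` with the `𝔪𝔬𝔡`-side local
portion over an ARBITRARY field `k` with a valuation subring `O` and an abstract logarithm on units. THIS FILE
(same seat; proof-only, no `def`, no new `Prop`) specialises it to THE carrier the text prints and the cone
consumes (abc-iut-f-197's `LocalLogShellsHolds.lean`, «THE named instance»): the completion
`F_v = v.adicCompletion F` of the number field `F = F_mod` itself at a finite place `v`, its valuation ring
`𝒪_v = v.adicCompletionIntegers F`, and ANY additive `logk : 𝒪_v^× → F_v` — among which THE `p_v`-adic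
logarithm (the analytic formula clause of abc-iut-f-197's `exists_formula_and_integersSubsetLogShell_holds` /
abc-iut-c312-5's `Summit.ABC.IUTFork.Thm311.Real.analyticLogv F v`) — while the `MOD` side is the Kummer
column of number fields `κ_m : K_m ⥲ F` onto the SAME `F` (Prop. 3.10 (i)). So both columns of Rmk. 3.10.1
now sit over one number field and its genuine local portion:

* (private) `exists_not_mem_adicCompletionIntegers` — `𝒪_v ≠ F_v` (a finite place is a nontrivial valuation:
  the inverse of a nonzero element of `𝔭_v` is not `v`-integral) [folklore; the nontriviality input of the model];
* **`remark3101ii_contrast_adicCompletion`** — `Remark3101ii_contrast` HOLDS for (`MOD`: `𝓕⊛(K_m)` with the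
  log-link-induced transports along `κ_{m+1}⁻¹ ∘ κ_m`, coric `𝓕⊛(F)`; `𝔪𝔬𝔡`: regions of `F_v` with the
  log-link-induced `E ↦ Φ (log (E ∩ 𝒪_v^×))`, every post-processing `Φ`, every additive `logk`);
* `remark3101i_noCompatibleIso_adicCompletion` — the `𝔪𝔬𝔡`-side clause of Rmk. 3.10.1 (i) alone at `(F_v, 𝒪_v)`,
  for every coric object;
* `remark3101ii_contrast_adicCompletion_frak_witness` — non-vacuity of the `𝔪𝔬𝔡` conjunct through the genuine
  coric identification (`Equiv.refl`), as in the model file.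

HONEST SCOPE as in the model file: the ONE modelling step is the shape `E ↦ Φ (log (E ∩ 𝒪^×))` of the map the
log-link induces on local regions (it acts on Frobenius-like local data only through `log : 𝒪^× → F_v`,
[IUTchIII] Def. 1.1 (i)); `Φ` and `logk` are universally quantified, so THE `p_v`-adic logarithm and every
normalisation of the log-image are covered. Not done: Def. 1.1's ind-topological packaging, the Frobenioid
structure on `𝓕⊛_𝔪𝔬𝔡`, the assembly over all `v`. No side taken on [IUTchIII] Cor. 3.12; nothing here says abc
is proved or refuted; typed ≠ proved elsewhere. [claim: Mochizuki2012, status: disputed]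
-/

noncomputable section

namespace Literature.IUT.LogThetaLattice

open IsDedekindDomain NumberField GlobalFrobenioidModels

variable (F : Type) [Field F] [NumberField F] (v : HeightOneSpectrum (𝓞 F))

/-- A finite place is a NONTRIVIAL valuation of the completion: some element of `F_v` is not `v`-integral
(the inverse of the image of a nonzero element of `𝔭_v`); private helper. [folklore] -/
private theorem exists_not_mem_adicCompletionIntegers :
    ∃ a : v.adicCompletion F, a ∉ v.adicCompletionIntegers F := by
  obtain ⟨π, hπ, hπ0⟩ := Submodule.exists_mem_ne_zero_of_ne_bot v.ne_bot
  have hlt : v.valuation F (algebraMap (𝓞 F) F π) < 1 := by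
    rw [HeightOneSpectrum.valuation_of_algebraMap]
    exact (HeightOneSpectrum.intValuation_lt_one_iff_mem v π).mpr hπ
  have hne : v.valuation F (algebraMap (𝓞 F) F π) ≠ 0 := by
    rw [HeightOneSpectrum.valuation_of_algebraMap]
    exact v.intValuation_ne_zero π hπ0
  refine ⟨((algebraMap (𝓞 F) F π : F) : v.adicCompletion F)⁻¹, ?_⟩
  rw [HeightOneSpectrum.mem_adicCompletionIntegers, map_inv₀,
    HeightOneSpectrum.valuedAdicCompletion_eq_valuation', inv_le_one₀ (zero_lt_iff.mpr hne), not_le]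
  exact hlt

/-- **[IUTchIII] Rmk. 3.10.1 (i), `𝔪𝔬𝔡` side, AT THE GENUINE LOCAL PORTION `(F_v, 𝒪_v)`**: for the column of
regions of `F_v` under the log-link-induced maps `E ↦ Φ (log (E ∩ 𝒪_v^×))` (any additive `logk` on `𝒪_v^×` — in
particular THE `p_v`-adic logarithm — and any post-processing `Φ`), "one cannot construct log-link-compatible
isomorphisms" with ANY coric object `C`. ([IUTchIII] Rmk 3.10.1 (i) p.149–150) [claim: Mochizuki2012, status: disputed] -/
theorem remark3101i_noCompatibleIso_adicCompletion
    (logk : Additive (↥(v.adicCompletionIntegers F))ˣ →+ v.adicCompletion F)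
    (Φ : Set (v.adicCompletion F) → Set (v.adicCompletion F)) (C : Type) :
    Literature.IUT.LogThetaLattice.Remark3101i_noCompatibleIso (C := C)
      (fun _ : ℤ => Set (v.adicCompletion F))
      (fun (_ : ℤ) (E : Set (v.adicCompletion F)) =>
        Φ ((fun x : (↥(v.adicCompletionIntegers F))ˣ => logk (Additive.ofMul x)) ''
          {x : (↥(v.adicCompletionIntegers F))ˣ |
            ((x : ↥(v.adicCompletionIntegers F)) : v.adicCompletion F) ∈ E})) :=
  remark3101i_noCompatibleIso_frakLocal (v.adicCompletionIntegers F) logk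
    (exists_not_mem_adicCompletionIntegers F v) Φ C

/-- **[IUTchIII] Rmk. 3.10.1 (ii) — THE `MOD`/`𝔪𝔬𝔡` CONTRAST over ONE number field `F = F_mod` and its genuine
local portion at a finite place `v`.** `MOD`: any Kummer column of number fields `κ_m : K_m ⥲ F` (Prop. 3.10
(i)), the model global Frobenioids `𝓕⊛(K_m)` with the log-link-induced transports along `κ_{m+1}⁻¹ ∘ κ_m`, coric
`𝓕⊛(F)` — a log-link-compatible Kummer family EXISTS (`prop310iii_model`); `𝔪𝔬𝔡`: the regions of
`F_v = v.adicCompletion F` under `E ↦ Φ (log (E ∩ 𝒪_v^×))`, `𝒪_v = v.adicCompletionIntegers F`, ANY additive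
`logk` (in particular THE `p_v`-adic logarithm) — NO compatible family exists. By the model theorem
`remark3101ii_contrast_model` at the nontrivial valuation ring `𝒪_v` (`exists_not_mem_adicCompletionIntegers`).
([IUTchIII] Rmk 3.10.1 (ii) p.150; Cor 3.12 proof Steps (ix)/(x) p.180) [claim: Mochizuki2012, status: disputed] -/
theorem remark3101ii_contrast_adicCompletion {Kf : ℤ → Type} [∀ m, Field (Kf m)] (κ : ∀ m, Kf m ≃+* F)
    (logk : Additive (↥(v.adicCompletionIntegers F))ˣ →+ v.adicCompletion F)
    (Φ : Set (v.adicCompletion F) → Set (v.adicCompletion F)) :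
    Literature.IUT.LogThetaLattice.Remark3101ii_contrast (FrakObj (ModelPlaces F) (fun _ => ℝ))
      (Set (v.adicCompletion F))
      (fun m => FrakObj (ModelPlaces (Kf m)) (fun _ => ℝ)) (fun _ => Set (v.adicCompletion F))
      (fun m => ⇑(frakTransport ((κ m).trans (κ (m + 1)).symm)))
      (fun (_ : ℤ) (E : Set (v.adicCompletion F)) =>
        Φ ((fun x : (↥(v.adicCompletionIntegers F))ˣ => logk (Additive.ofMul x)) ''
          {x : (↥(v.adicCompletionIntegers F))ˣ |
            ((x : ↥(v.adicCompletionIntegers F)) : v.adicCompletion F) ∈ E})) :=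
  remark3101ii_contrast_model (v.adicCompletionIntegers F) logk κ
    (exists_not_mem_adicCompletionIntegers F v) Φ

/-- Non-vacuity of the `𝔪𝔬𝔡` conjunct at `(F_v, 𝒪_v)`: through the GENUINE coric identification `Equiv.refl` the
contrast yields a NON-BIJECTIVE `𝔪𝔬𝔡`-side log-link map (abc-iut-L6-d3's `.exists_not_bijective_frak`), so the
second conjunct holds for the printed reason ("one-sided inclusions"), not the junk one.
([IUTchIII] Rmk 3.10.1 (i)(ii) p.149–150) [claim: Mochizuki2012, status: disputed] -/
theorem remark3101ii_contrast_adicCompletion_frak_witness {Kf : ℤ → Type} [∀ m, Field (Kf m)]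
    (κ : ∀ m, Kf m ≃+* F) (logk : Additive (↥(v.adicCompletionIntegers F))ˣ →+ v.adicCompletion F)
    (Φ : Set (v.adicCompletion F) → Set (v.adicCompletion F)) :
    ∃ m : ℤ, ¬ Function.Bijective
      ((fun (_ : ℤ) (E : Set (v.adicCompletion F)) =>
        Φ ((fun x : (↥(v.adicCompletionIntegers F))ˣ => logk (Additive.ofMul x)) ''
          {x : (↥(v.adicCompletionIntegers F))ˣ |
            ((x : ↥(v.adicCompletionIntegers F)) : v.adicCompletion F) ∈ E})) m) :=
  (remark3101ii_contrast_adicCompletion F v κ logk Φ).exists_not_bijective_frak (Equiv.refl _)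

end Literature.IUT.LogThetaLattice

end
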